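import Summits.QuantumAdvantage.QuantumAdvantage.Theorems.CubicForrelationNearExactIsExactCubicFormR2PartnerCells
import Summits.QuantumAdvantage.QuantumAdvantage.Theorems.CubicForrelationNearExactIsExactCubicFormPartnerTransport
import Summits.QuantumAdvantage.QuantumAdvantage.Theorems.CubicForrelationNearExactIsExactCubicFormBlockFrame
import Summits.QuantumAdvantage.QuantumAdvantage.Theorems.CubicForrelationNearExactIsExactTwelvePartnerLight
import Summits.QuantumAdvantage.QuantumAdvantage.Theorems.CubicForrelationNearExactIsExactKtThreeExceptionalCoords
import Summits.QuantumAdvantage.QuantumAdvantage.Theorems.CubicForrelationNearExactIsExactCubicFormCellL3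
import Summits.QuantumAdvantage.QuantumAdvantage.Theorems.CubicForrelationNearExactIsExactCubicFormCellL3Weight
import Summits.QuantumAdvantage.QuantumAdvantage.Theorems.CubicForrelationNearExactIsExactTwelvePartnerR2LeafTT

/-!
# Crux `CubicForrelation.NearExactIsExact` (stmt-QuantumAdvantage-14043) — E1280-even, R2 branch: the EXCEPTIONAL level (descendant `T ⊕ T′`,
  light cell of weight `112` in no hyperplane) END-TO-END

Certificate seat `b2b-cforr-cert` (gen 42).  HONEST FRAMING: kernel-checked assembly (standard axioms) of the `T⊕T′` endgame of R2-PARTNER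
§4(TT′) / E1280-HANDPROOFS §1.7 (radical): the light cell in the exceptional coordinates of `kte_cell_coords` (cubic form
`s₀s₁s₂ ⊕ s₃s₄s₅` at `s₀..s₅`, radical `R₃ = {s₆,s₇,s₈}`), the whole partner package transported along the block frame (`tbf_block_frame`,
`tpw_partner_transport`, `tpw_block_frame_identity`, `tpw_F1_of_frame_identity`), every free cell weighing `≥ 112` (`tl3_weight_ge`) hence
`< 160`, cell lemma L3 in matrix form (`tl3_matrix_rows`: second differences through `R₃` vanish) for the light cell and its two neighbours —
so `t̄`, `G`, `Γ` have no `R₃`-rows — and the leaf `tpa_R2_TT` (a radical vector of `d`).  It discharges the hypothesis `HEXC` of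
`tpw_R2_frame_false_of_branches` (…CubicFormR2PartnerCells).  NOT summit progress.

* `tpw_R2_level_exc`: `HEXC`.

References: this seat lineage (g36 L3/L5, g37 R2-PARTNER §4(TT′), g39 leaf `tpa_R2_TT`, g41 `kte_cell_coords`, cell lemma L3).  Axioms: the
standard three.
-/

set_option linter.dupNamespace false -- D-0017: single-problem summit ⇒ `QuantumAdvantage.QuantumAdvantage` by design

namespace Summit.QuantumAdvantage.QuantumAdvantage.Theorems.CubicForrelation.NearExactIsExact

open Finset
open Literature.Computability.QuantumComplexity
open Literature.Computability.QuantumComplexity.BuzetChailloux (bxor zeroVec bxor_comm bxor_self bxor_zeroVec zeroVec_bxor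
  bxor_bxor_cancel_left)

/-- **The exceptional level (`T⊕T′`) of the R2 branch.**  See the module docstring. [this work] -/
theorem tpw_R2_level_exc :
    ∀ (κ : (Fin (3 + 9) → Bool) → Bool), IsDegLeFun 3 κ →
    ∀ (c d : Fin (3 + 9) → Fin (3 + 9) → Fin (3 + 9) → ZMod 2),
    (∀ p j k, c p k j = c p j k) → (∀ p j k, c j p k = c p j k) → (∀ p j, c p j j = 0) →
    (∀ φ j k, d φ k j = d φ j k) → (∀ φ j k, d j φ k = d φ j k) → (∀ φ j, d φ j j = 0) →
    (∀ φ j k, d φ j k =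
      if ((((κ zeroVec ^^ κ (bxor zeroVec (fun l => decide (l = k)))) ^^
              (κ (bxor zeroVec (fun l => decide (l = j))) ^^ κ (bxor (bxor zeroVec (fun l => decide (l = j))) (fun l => decide (l = k))))) ^^
            ((κ (bxor zeroVec (fun l => decide (l = φ))) ^^ κ (bxor (bxor zeroVec (fun l => decide (l = φ))) (fun l => decide (l = k)))) ^^
              (κ (bxor (bxor zeroVec (fun l => decide (l = φ))) (fun l => decide (l = j))) ^^
                κ (bxor (bxor (bxor zeroVec (fun l => decide (l = φ))) (fun l => decide (l = j))) (fun l => decide (l = k))))))) = true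
      then 1 else 0) →
    (∀ p φ, (∑ j, ∑ k, (if j < k then c p j k * d φ j k else 0)) = if p = φ then 1 else 0) →
    (∀ y, (κ y ^^ κ (bxor y (fun l => decide (l = Fin.castAdd 9 (0 : Fin 3))))) =
      (y (Fin.castAdd 9 (1 : Fin 3)) && y (Fin.castAdd 9 (2 : Fin 3)))) →
    (∀ j k, d (Fin.castAdd 9 0) j k =
      if (j = Fin.castAdd 9 1 ∧ k = Fin.castAdd 9 2) ∨ (j = Fin.castAdd 9 2 ∧ k = Fin.castAdd 9 1) then 1 else 0) →
    #(univ.filter fun s : Fin 9 → Bool => κ (Fin.append ![false, false, false] s) = true) +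
      #(univ.filter fun s : Fin 9 → Bool => κ (Fin.append ![false, false, true] s) = true) +
      #(univ.filter fun s : Fin 9 → Bool => κ (Fin.append ![false, true, false] s) = true) < 384 →
    ∀ (i j : Bool), (i && j) = false →
    (∀ i' j' : Bool, (i' && j') = false →
      #(univ.filter fun s : Fin 9 → Bool => κ (Fin.append ![false, i, j] s) = true) ≤
        #(univ.filter fun s : Fin 9 → Bool => κ (Fin.append ![false, i', j'] s) = true)) →
    0 < #(univ.filter fun s : Fin 9 → Bool => κ (Fin.append ![false, i, j] s) = true) →
    32 * #(univ.filter fun s : Fin 9 → Bool => κ (Fin.append ![false, i, j] s) = true) = 7 * 2 ^ 9 →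
    (¬ ∃ (z : Fin 9 → Bool) (b : Bool), z ≠ zeroVec ∧
      ∀ s, κ (Fin.append ![false, i, j] s) = true → decide (Odd #(univ.filter fun l => (s l && z l) = true)) = b) → False := by
  intro κ hκ c d hcs hcc hcd hds hdc hdd hd hpair hD0 hF1 hsum i j hij hmin hpos hexc hgen
  obtain ⟨hcub, -, -⟩ := tpw_R2_cells κ hκ d hd hD0
  have hρ := hcub ![false, i, j]
  obtain ⟨hm, P, Pi, hPPi, hPiP, hform⟩ := kte_cell_coords (fun s : Fin 9 → Bool => κ (Fin.append ![false, i, j] s)) hρ hexc hgen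
  -- block frame and transport of the package
  obtain ⟨L, Li, hLLi, hLiL, hLapp, -, hyy, hys, hsy, -⟩ := tbf_block_frame P Pi hPPi hPiP
  obtain ⟨κ', c', d', hκap, -, -, hκ'3, -, hcs', hcc', hcd', hd'T, hpair'⟩ :=
    tpw_partner_transport κ hκ c d hcs hcc hcd hds hdd hd hpair L Li hLLi hLiL zeroVec
  have hD0' : ∀ y, (κ' y ^^ κ' (bxor y (fun l => decide (l = Fin.castAdd 9 (0 : Fin 3))))) =
      (y (Fin.castAdd 9 (1 : Fin 3)) && y (Fin.castAdd 9 (2 : Fin 3))) := fun y => by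
    rw [hκap, hκap]
    exact tpw_block_frame_identity κ L hyy hys hsy hD0 zeroVec rfl rfl y
  have hF1' := tpw_F1_of_frame_identity κ' d' hd'T hD0'
  obtain ⟨hds', hdc', hdd''⟩ := tpw_d_symm κ' d' hd'T
  obtain ⟨hcub', htb', -⟩ := tpw_R2_cells κ' hκ'3 d' hd'T hD0'
  have hcell : ∀ (vv : Fin 3 → Bool) (s : Fin 9 → Bool), κ' (Fin.append vv s) =
      κ (Fin.append vv (fun σ => decide ((∑ σ', P σ σ' * (if s σ' = true then (1 : ZMod 2) else 0)) = 1))) := by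
    intro vv s
    rw [hκap, hLapp vv s, zeroVec_bxor]
  have hW : ∀ i' j' : Bool, #(univ.filter fun s : Fin 9 → Bool => κ' (Fin.append ![false, i', j'] s) = true) =
      #(univ.filter fun s : Fin 9 → Bool => κ (Fin.append ![false, i', j'] s) = true) := by
    intro i' j'
    have e := tct_card_comp P Pi hPPi hPiP zeroVec (fun s : Fin 9 → Bool => κ (Fin.append ![false, i', j'] s) = true)
    simp only [zeroVec_bxor] at e
    simp only [hcell]
    exact e
  -- the light cell's third differences in the new coordinates: `T ⊕ T′` on `s₀..s₅`
  have e0 : (Fin.castLE hm (0 : Fin 6) : Fin 9) = 0 := Fin.ext (by simp)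
  have e1 : (Fin.castLE hm (1 : Fin 6) : Fin 9) = 1 := Fin.ext (by simp)
  have e2 : (Fin.castLE hm (2 : Fin 6) : Fin 9) = 2 := Fin.ext (by simp)
  have e3 : (Fin.castLE hm (3 : Fin 6) : Fin 9) = 3 := Fin.ext (by simp)
  have e4 : (Fin.castLE hm (4 : Fin 6) : Fin 9) = 4 := Fin.ext (by simp)
  have e5 : (Fin.castLE hm (5 : Fin 6) : Fin 9) = 5 := Fin.ext (by simp)
  have hTexc : ∀ u v w x : Fin 9 → Bool,
      ((((κ' (Fin.append ![false, i, j] x) ^^ κ' (Fin.append ![false, i, j] (bxor x w))) ^^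
            (κ' (Fin.append ![false, i, j] (bxor x v)) ^^ κ' (Fin.append ![false, i, j] (bxor (bxor x v) w)))) ^^
          ((κ' (Fin.append ![false, i, j] (bxor x u)) ^^ κ' (Fin.append ![false, i, j] (bxor (bxor x u) w))) ^^
            (κ' (Fin.append ![false, i, j] (bxor (bxor x u) v)) ^^
              κ' (Fin.append ![false, i, j] (bxor (bxor (bxor x u) v) w)))))) =
      (((((u 0 && (v 1 && w 2)) ^^ (u 0 && (v 2 && w 1))) ^^ ((u 1 && (v 0 && w 2)) ^^ (u 1 && (v 2 && w 0)))) ^^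
            ((u 2 && (v 0 && w 1)) ^^ (u 2 && (v 1 && w 0)))) ^^
         ((((u 3 && (v 4 && w 5)) ^^ (u 3 && (v 5 && w 4))) ^^ ((u 4 && (v 3 && w 5)) ^^ (u 4 && (v 5 && w 3)))) ^^
            ((u 5 && (v 3 && w 4)) ^^ (u 5 && (v 4 && w 3))))) := by
    intro u v w x
    have h3 := tct_third_comp (fun s : Fin 9 → Bool => κ (Fin.append ![false, i, j] s)) P zeroVec u v w x
    dsimp only at h3
    simp only [zeroVec_bxor] at h3
    have hf := hform u v w (fun σ => decide ((∑ σ', P σ σ' * (if x σ' = true then (1 : ZMod 2) else 0)) = 1))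
    dsimp only at hf
    rw [e0, e1, e2, e3, e4, e5] at hf
    simp only [hcell]
    rw [h3]
    exact hf
  -- all cells share the third differences
  have hT' : ∀ (vv : Fin 3 → Bool) (u v w x : Fin 9 → Bool),
      ((((κ' (Fin.append vv x) ^^ κ' (Fin.append vv (bxor x w))) ^^
            (κ' (Fin.append vv (bxor x v)) ^^ κ' (Fin.append vv (bxor (bxor x v) w)))) ^^
          ((κ' (Fin.append vv (bxor x u)) ^^ κ' (Fin.append vv (bxor (bxor x u) w))) ^^
            (κ' (Fin.append vv (bxor (bxor x u) v)) ^^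
              κ' (Fin.append vv (bxor (bxor (bxor x u) v) w)))))) =
      (((((u 0 && (v 1 && w 2)) ^^ (u 0 && (v 2 && w 1))) ^^ ((u 1 && (v 0 && w 2)) ^^ (u 1 && (v 2 && w 0)))) ^^
            ((u 2 && (v 0 && w 1)) ^^ (u 2 && (v 1 && w 0)))) ^^
         ((((u 3 && (v 4 && w 5)) ^^ (u 3 && (v 5 && w 4))) ^^ ((u 4 && (v 3 && w 5)) ^^ (u 4 && (v 5 && w 3)))) ^^
            ((u 5 && (v 3 && w 4)) ^^ (u 5 && (v 4 && w 3))))) := by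
    intro vv u v w x
    have h1 := tcc_third_rho κ' vv u v w x
    have h2 := tcc_third_rho κ' ![false, i, j] u v w x
    dsimp only at h1 h2
    rw [h1, tcf_third_const κ' hκ'3 _ _ _ (Fin.append vv x) (Fin.append ![false, i, j] x), ← h2]
    exact hTexc u v w x
  -- weights: every free cell weighs at least 112, hence fewer than 160
  have lb : ∀ vv : Fin 3 → Bool, 112 ≤ #(univ.filter fun s : Fin 9 → Bool => κ' (Fin.append vv s) = true) := fun vv =>
    tl3_weight_ge (fun s : Fin 9 → Bool => κ' (Fin.append vv s)) (hcub' vv) (hT' vv)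
  have hsum' : #(univ.filter fun s : Fin 9 → Bool => κ' (Fin.append ![false, false, false] s) = true) +
      #(univ.filter fun s : Fin 9 → Bool => κ' (Fin.append ![false, false, true] s) = true) +
      #(univ.filter fun s : Fin 9 → Bool => κ' (Fin.append ![false, true, false] s) = true) < 384 := by
    rw [hW, hW, hW]; exact hsum
  have l0 := lb ![false, false, false]
  have l1 := lb ![false, false, true]
  have l2 := lb ![false, true, false]
  have hw00 : #(univ.filter fun s : Fin 9 → Bool => κ' (Fin.append ![false, false, false] s) = true) < 160 := by omega
  have hw01 : #(univ.filter fun s : Fin 9 → Bool => κ' (Fin.append ![false, false, true] s) = true) < 160 := by omega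
  have hw10 : #(univ.filter fun s : Fin 9 → Bool => κ' (Fin.append ![false, true, false] s) = true) < 160 := by omega
  -- second differences through `R₃ = {6,7,8}` vanish for the three free cells (cell lemma L3, matrix form)
  have hR : ∀ (vv : Fin 3 → Bool), #(univ.filter fun s : Fin 9 → Bool => κ' (Fin.append vv s) = true) < 160 →
      ∀ (r : Fin 3) (k : Fin 9),
        ((κ' (Fin.append vv zeroVec) ^^ κ' (Fin.append vv (fun l => decide (l = k)))) ^^
          (κ' (Fin.append vv (fun l => decide (l = Fin.natAdd 6 r))) ^^
            κ' (Fin.append vv (bxor (fun l => decide (l = Fin.natAdd 6 r)) (fun l => decide (l = k)))))) = false := by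
    intro vv hwt r k
    exact tl3_matrix_rows (fun s : Fin 9 → Bool => κ' (Fin.append vv s)) (hcub' vv) (hT' vv) hwt (Fin.natAdd 6 r) k (by simp)
  -- normal forms of the unit vectors of `3 + 9` bits
  have hz3 : (zeroVec : Fin 3 → Bool) = ![false, false, false] := by decide
  have he1 : (fun l : Fin 3 => decide (l = (1 : Fin 3))) = ![false, true, false] := by decide
  have he2 : (fun l : Fin 3 => decide (l = (2 : Fin 3))) = ![false, false, true] := by decide
  -- the mixed slices `G`, `Γ` have no `R₃`-rows
  have hGR : ∀ (r : Fin 3) (s : Fin (6 + 3)), d' (Fin.castAdd 9 1) (Fin.natAdd 3 (Fin.natAdd 6 r)) (Fin.natAdd 3 s) = 0 := by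
    intro r s
    rw [hd'T]
    simp only [zeroVec_bxor]
    rw [← tcc_append_zero, tcc_unit_left, tcc_unit_right, tcc_unit_right]
    simp only [tcc_append_bxor, zeroVec_bxor, bxor_zeroVec]
    simp only [hz3, he1]
    rw [hR _ hw00 r s, hR _ hw10 r s]
    exact if_neg Bool.false_ne_true
  have hΓR : ∀ (r : Fin 3) (s : Fin (6 + 3)), d' (Fin.castAdd 9 2) (Fin.natAdd 3 (Fin.natAdd 6 r)) (Fin.natAdd 3 s) = 0 := by
    intro r s
    rw [hd'T]
    simp only [zeroVec_bxor]
    rw [← tcc_append_zero, tcc_unit_left, tcc_unit_right, tcc_unit_right]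
    simp only [tcc_append_bxor, zeroVec_bxor, bxor_zeroVec]
    simp only [hz3, he2]
    rw [hR _ hw00 r s, hR _ hw01 r s]
    exact if_neg Bool.false_ne_true
  -- `t̄` has no `R₃`-rows
  have hlow : ∀ r : Fin 3, decide ((0 : Fin 9) = Fin.natAdd 6 r) = false ∧ decide ((1 : Fin 9) = Fin.natAdd 6 r) = false ∧
      decide ((2 : Fin 9) = Fin.natAdd 6 r) = false ∧ decide ((3 : Fin 9) = Fin.natAdd 6 r) = false ∧
      decide ((4 : Fin 9) = Fin.natAdd 6 r) = false ∧ decide ((5 : Fin 9) = Fin.natAdd 6 r) = false := by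
    decide
  have htbR : ∀ (r : Fin 3) (s t : Fin (6 + 3)),
      d' (Fin.natAdd 3 (Fin.natAdd 6 r)) (Fin.natAdd 3 s) (Fin.natAdd 3 t) = 0 := by
    intro r s t
    rw [htb' ![false, i, j] (Fin.natAdd 6 r) s t zeroVec, hTexc]
    obtain ⟨q0, q1, q2, q3, q4, q5⟩ := hlow r
    simp only [q0, q1, q2, q3, q4, q5, Bool.false_and, Bool.xor_false]
    exact if_neg Bool.false_ne_true
  exact tpa_R2_TT c' d' hds' hdc' hdd'' hpair' hF1' htbR hGR hΓR

end Summit.QuantumAdvantage.QuantumAdvantage.Theorems.CubicForrelation.NearExactIsExact
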